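import Summits.BirchSwinnertonDyer.BirchSwinnertonDyer.Theorems.TameQuarticManinParityTprimeHeegnerUpperOfManinUnitIrreducibleRows
import Summits.BirchSwinnertonDyer.Rank1Residual.X11b.Three.KolyvaginLine
import HarnessLib

/-!
# Crux X₄ `TprimeHeegnerUpperOfManinUnit` (stmt-BirchSwinnertonDyer-23738), line `rows_of_manin_unit` v2 (3c59fc8b80b3):
# the research stub Σ `stub_sigmaIrreducibleOptimalRows` IS, frame by frame, the `≥`-half of the REFINED KOLYVAGIN
# CONJECTURE `𝓜_∞ ≥ ord₃ ∏_ℓ c_ℓ(E)` in the tree's McCallum currency (`X11b.Three.Koly.Minf`) — an `Iff.intro` of order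
# theory on the KOLY-LINE objects, so that Σ can be read, attacked and cited in the language of Jetchev 2008 Conj. 1.3 /
# W. Zhang 2014 / Burungale–Castella–Grossi–Skinner 2026 Thm. 2

HONEST FRAMING. Theorems only; helper file (`--supports stmt-BirchSwinnertonDyer-23738 --as helper`, leafhand
`leafhand-bsd-tamequarticmaninpa-4` g0, 2026-08-31); no definition, no named fact, no `sorry`; nothing is asserted about any
curve; no stub is closed by name, no item is closed, BSD is proved for no curve, Σ is NOT proved. Companion of
`…SigmaTight.lean` (Σ ⟸ PUB + the `3`-adic upper halves; sandwich).

* §1 `globalDivisibility_iff_natCast_le_minf` — for ANY frame `(Dt, β, ι)` at level `N`, prime `p` and depth `T`: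
  «every derived Heegner point `P_n` (`n` square-free, Kolyvagin primes of index `≥ s′`) is `p^{s′}`-divisible in `E(K[n])` for
  all `s′ ≤ T`» ↔ «`T ≤ M_∞`», where `M_∞ = Koly.Minf Dt β ι p` is McCallum's `min_r M_r`,
  `M_r = min{ord_p(P_n) : n ∈ S_r(ord_p(P_n)+1)}` (tree objects of `X11b/Three/KolyvaginLine.lean`, infima in `ℕ∞`, no
  empty-infimum junk). (→): a datum entering `M_r` with `ord_p(P_n) = M < T` lies in `S_r(M+1)`, so depth `M+1 ≤ T` of the
  hypothesis makes `p^{M+1} ∣ P_n`, absurd; (←): a failure at depth `s′ ≥ 1` is a level-`s′` certificate, so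
  `minf_le_of_certificate` gives `M_∞ ≤ s′ − 1 < T`.
* §2 `sigmaIrreducibleOptimalRows_iff_tamagawaExponent_le_minf` — **Σ VERBATIM ↔ Σ_𝓜**, where Σ_𝓜 has Σ's binders and the
  conclusion `(ord₃ ∏_ℓ c_ℓ(W) : ℕ∞) ≤ Koly.Minf Dt H.β ι 3`: on the irreducible non-CM (t′) rank-one optimal rows with a
  Manin-clean datum, at every Heegner frame with odd `d_K`, `L(E^{(d_K)},1) ≠ 0` and `P = y_K` non-torsion,
  **`𝓜_∞ ≥ ord₃ ∏_ℓ c_ℓ(E)`** — the `≥`-half of the refined Kolyvagin conjecture (Jetchev 2008 Conj. 1.3 «`m_∞ = ord_p ∏ c_q`»;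
  proved for `p > 3` good ordinary, `ρ̄` onto, `p` split, `p`-optimal `π` by Burungale–Castella–Grossi–Skinner 2026 Thm. 2,
  tree named fact `BurungaleCastellaGrossiSkinner2026.thm2_…` in the CLASS currency; Jetchev's Thm. 1.4 is the single-carrier
  inequality `m_∞ ≥ max_q ord_p c_q`, `p ∤ N`). So the research content of Σ beyond the mono-carrier rows (p824349) is
  EXACTLY «refined Kolyvagin `≥` at the ADDITIVE potentially good prime `3` of type (t′), `E[3]` irreducible» — in print for
  no class (BCGS need `p > 3` good ordinary and the integral anticyclotomic main conjecture).

References: [cite: McCallumLMS1991, §5 (p. 303) `M_r`, Cor. 5.6 (p. 310)] [cite: Jetchev2008, Conj. 1.3, Thm. 1.4 (p. 812)]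
[cite: BurungaleEtAl2026, Thm. 2 (§0.1)] [cite: WZhang2014, Notations (xii)] [cite: GrossLMS1991, §4 (4.1)].
-/

-- D-0017: single-problem summit, so `Summit.BirchSwinnertonDyer.BirchSwinnertonDyer.…` repeats a namespace BY DESIGN.
set_option linter.dupNamespace false
set_option autoImplicit false

noncomputable section

open scoped Classical NumberField
open WeierstrassCurve IsDedekindDomain NumberField Literature Literature.NumberTheory.EllipticCurves
  Literature.NumberTheory.EllipticCurves.ModularForms
  Literature.NumberTheory.EllipticCurves.Rank1Residual
  Literature.NumberTheory.EllipticCurves.Rank1Residual.Typed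
  Literature.NumberTheory.QuadraticFields
  Summit.BirchSwinnertonDyer.Rank1Residual
  Summit.BirchSwinnertonDyer.Rank1Residual.Additive
  Summit.BirchSwinnertonDyer.Rank1Residual.X11b
  Summit.BirchSwinnertonDyer.Rank1Residual.X11b.Three
  Summit.BirchSwinnertonDyer.BirchSwinnertonDyer.Theorems

namespace Summit.BirchSwinnertonDyer.BirchSwinnertonDyer.Theorems.TprimeHeegnerUpperOfManinUnit

/-! ## §1 Frame level: global divisibility to depth `T` ↔ `T ≤ M_∞` -/

/-- **Global `p^{s′}`-divisibility of the derived Heegner points to depth `T` ↔ `T ≤ M_∞`** on one frame `(Dt, β, ι)` at level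
`N`: the Σ-form «for every `s′ ≤ T`, every square-free `n` whose prime factors are Kolyvagin primes of index `≥ s′`, and every
Kolyvagin–Heegner datum `d` of conductor `n`, `p^{s′} ∣ P_n` in `E(K[n])`» is EQUIVALENT to `(T : ℕ∞) ≤ Koly.Minf Dt β ι p`
(McCallum's `M_∞ = min_r M_r`, `M_r = min{ord_p(P_n) : n ∈ S_r(ord_p(P_n)+1)}`, tree objects). (→) a datum entering `M_r` with
`ord_p(P_n) = M < T` has `n ∈ S_r(M+1)` and `M + 1 ≤ T`, so the hypothesis gives `p^{M+1} ∣ P_n`, contradicting `ord_p(P_n) = M`;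
(←) a failure of `p^{s′} ∣ P_n` (`s′ ≥ 1`) is a level-`s′` certificate on `n ∈ S_r(s′)`, whence `M_∞ ≤ s′ − 1`
(`minf_le_of_certificate`). Pure order theory; nothing asserted. [cite: McCallumLMS1991, §5 (p. 303) and Cor. 5.6 (p. 310)]
[cite: Jetchev2008, Conj. 1.3 (p. 812)] -/
theorem globalDivisibility_iff_natCast_le_minf {N : ℕ} [NeZero N] {W : WeierstrassCurve ℚ} [W.IsGloballyMinimal]
    {K : Type} [Field K] [NumberField K] {Dt : ModularParametrizationData W N} {β : ℤ} {ι : K →+* ℂ} (p T : ℕ) :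
    (∀ (s' : ℕ), s' ≤ T → ∀ (n : ℕ) (d : KolyvaginHeegnerData Dt β ι n), Squarefree n →
      (∀ ℓ ∈ n.primeFactors, Zhang2014.IsKolyvaginPrime N W K p ℓ ∧ s' ≤ Zhang2014.kolyvaginIndex W p ℓ) →
        Koly.PDiv d p s') ↔
    (T : ℕ∞) ≤ Koly.Minf Dt β ι p := by
  constructor
  · intro h
    refine le_iInf fun r ↦ le_iInf fun n ↦ le_iInf fun d ↦ le_iInf fun hex ↦ ?_
    obtain ⟨M, hM, hmem⟩ := hex
    rw [hM]
    by_contra hlt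
    have hMT : M + 1 ≤ T := by
      have : (M : ℕ∞) < (T : ℕ∞) := not_le.mp hlt
      exact_mod_cast (ENat.coe_lt_coe.mp this : M < T)
    have hdiv : Koly.PDiv d p (M + 1) :=
      h (M + 1) hMT n d hmem.1 fun ℓ hℓ ↦ hmem.2.2 ℓ hℓ
    have hle : ((M + 1 : ℕ) : ℕ∞) ≤ Koly.divOrd d p :=
      le_iSup₂ (f := fun (M' : ℕ) (_ : Koly.PDiv d p M') ↦ (M' : ℕ∞)) (M + 1) hdiv
    rw [hM] at hle
    have : M + 1 ≤ M := by exact_mod_cast hle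
    omega
  · intro hT s' hs' n d hn hℓ
    by_contra hnd
    rcases Nat.eq_zero_or_pos s' with hs0 | hs0
    · subst hs0
      exact hnd (Koly.pDiv_zero d p)
    obtain ⟨M, rfl⟩ : ∃ M, s' = M + 1 := ⟨s' - 1, by omega⟩
    have hmem : Koly.MemS N W K p n.primeFactors.card (M + 1) n := ⟨hn, rfl, hℓ⟩
    have hle : Koly.Minf Dt β ι p ≤ M := Koly.minf_le_of_certificate d p hmem hnd
    have : (T : ℕ∞) ≤ (M : ℕ∞) := hT.trans hle
    have : T ≤ M := by exact_mod_cast this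
    omega

/-! ## §2 Σ VERBATIM ↔ the refined-Kolyvagin `≥`-inequality `ord₃ ∏_ℓ c_ℓ(E) ≤ M_∞` on the same rows and frames -/

/-- **Σ (the registered `stub_sigmaIrreducibleOptimalRows`, VERBATIM) ↔ Σ_𝓜**: on every globally minimal non-CM (t′) rank-one
`W` with `E[3]` irreducible, every datum `Dt` at level `N_E` with `3 ∤ c(Dt)`, every imaginary quadratic Heegner `K` of odd
discriminant with `L(E^{(d_K)},1) ≠ 0`, every frame `(H, ι)` and `P ↦ y_K` non-torsion:
**`(ord₃ ∏_ℓ c_ℓ(W) : ℕ∞) ≤ Koly.Minf Dt H.β ι 3`** — McCallum's `M_∞ ≥ ord₃ ∏ c_ℓ`, the `≥`-half of the refined Kolyvagin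
conjecture `𝓜_∞ = Σ_ℓ ord_p c_ℓ` (Jetchev 2008 Conj. 1.3; Burungale–Castella–Grossi–Skinner 2026 Thm. 2 for `p > 3` good
ordinary onto; Jetchev Thm. 1.4 = the single-carrier `≥`, `p ∤ N`). §1 frame by frame. So Σ's research content is exactly
«refined Kolyvagin `≥` at the additive (t′) prime `3`, irreducible image» — in print for no class. Nothing asserted; closes
nothing. [cite: Jetchev2008, Conj. 1.3 and Thm. 1.4 (p. 812)] [cite: BurungaleEtAl2026, Thm. 2 (§0.1)]
[cite: McCallumLMS1991, §5 Cor. 5.6 (p. 310)] -/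
theorem sigmaIrreducibleOptimalRows_iff_tamagawaExponent_le_minf :
    (∀ (W : WeierstrassCurve ℚ) [W.IsElliptic] [W.IsGloballyMinimal] [NeZero (W.conductorNorm ℤ)]
      (K : Type) [Field K] [NumberField K] (Dt : ModularParametrizationData W (W.conductorNorm ℤ))
      (H : HeegnerDatum (W.conductorNorm ℤ) (NumberField.discr K)) (ι : K →+* ℂ) (P : (W.baseChange K).toAffine.Point),
      ¬ W.HasCM → Addv W 3 → SubTprime W 3 → W.HasIrreducibleModPGaloisRep 3 → W.analyticRank = 1 →
      ¬ (3 : ℤ) ∣ Dt.c → IsImaginaryQuadratic K → SatisfiesHeegnerHypothesis (W.conductorNorm ℤ) K →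
      (W.quadraticTwist (NumberField.discr K : ℚ)).entireLFunction 1 ≠ 0 →
      WeierstrassCurve.Affine.Point.map ι.toRatAlgHom P = heegnerPointComplex Dt H → ¬ IsOfFinAddOrder P →
      Odd (NumberField.discr K) →
      ∀ (s' : ℕ), s' ≤ padicValNat 3 W.tamagawaProduct →
      ∀ (n : ℕ) (d : KolyvaginHeegnerData Dt H.β ι n), Squarefree n →
      (∀ ℓ ∈ n.primeFactors, Zhang2014.IsKolyvaginPrime (W.conductorNorm ℤ) W K 3 ℓ ∧
        s' ≤ Zhang2014.kolyvaginIndex W 3 ℓ) → Koly.PDiv d 3 s') ↔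
    (∀ (W : WeierstrassCurve ℚ) [W.IsElliptic] [W.IsGloballyMinimal] [NeZero (W.conductorNorm ℤ)]
      (K : Type) [Field K] [NumberField K] (Dt : ModularParametrizationData W (W.conductorNorm ℤ))
      (H : HeegnerDatum (W.conductorNorm ℤ) (NumberField.discr K)) (ι : K →+* ℂ) (P : (W.baseChange K).toAffine.Point),
      ¬ W.HasCM → Addv W 3 → SubTprime W 3 → W.HasIrreducibleModPGaloisRep 3 → W.analyticRank = 1 →
      ¬ (3 : ℤ) ∣ Dt.c → IsImaginaryQuadratic K → SatisfiesHeegnerHypothesis (W.conductorNorm ℤ) K →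
      (W.quadraticTwist (NumberField.discr K : ℚ)).entireLFunction 1 ≠ 0 →
      WeierstrassCurve.Affine.Point.map ι.toRatAlgHom P = heegnerPointComplex Dt H → ¬ IsOfFinAddOrder P →
      Odd (NumberField.discr K) →
      (padicValNat 3 W.tamagawaProduct : ℕ∞) ≤ Koly.Minf Dt H.β ι 3) := by
  constructor
  · intro h W _ _ _ K _ _ Dt H ι P hCM hadd hT hirr hr hc hK hHN hLt hP hnt hodd
    exact (globalDivisibility_iff_natCast_le_minf 3 (padicValNat 3 W.tamagawaProduct)).mp
      (h W K Dt H ι P hCM hadd hT hirr hr hc hK hHN hLt hP hnt hodd)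
  · intro h W _ _ _ K _ _ Dt H ι P hCM hadd hT hirr hr hc hK hHN hLt hP hnt hodd
    exact (globalDivisibility_iff_natCast_le_minf 3 (padicValNat 3 W.tamagawaProduct)).mpr
      (h W K Dt H ι P hCM hadd hT hirr hr hc hK hHN hLt hP hnt hodd)

end Summit.BirchSwinnertonDyer.BirchSwinnertonDyer.Theorems.TprimeHeegnerUpperOfManinUnit

end
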